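import Summits.QuantumFields.YangMills.Theorems.BalabanUVNodesN15KingModelSrcDivLetters
import Summits.QuantumFields.YangMills.Theorems.BalabanUVNodesN15KingModelSrcDivByParts
import Summits.QuantumFields.YangMills.Theorems.BalabanUVNodesN15KingModelDressedJetNoFit
import HarnessLib

/-!
# BalabanUVNodes ∕ N15 — THE KING-MODEL RUNG, PROGRAMME Y (the dressed SOURCE-DIVERGENCE entry of the King jet), FILE 70b:
# THE COARSE DRESSED ROWS — the (3.65) jet's fixed point is available (`1 − [ĜV̂]` a unit on both grids), the dressed third entry `Ȳ_κ = X̄∘N̄∇̄*_κ` and its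
# coarse gradient `N̄∇̄_μȲ_κ` (the DRESSED MIXED operator) have block majorants `B(K+2)e^{−δd}` — the bare mixed logarithm (FILE 68) through the jet's Neumann series

WHO ∕ WHEN.  Cell `pub-ymgap`, seat `pub-ymgap-dag-n15-d` (R134, N15 NE2 s3 = King-model rung, g22); `--kind proof --supports stmt-QuantumFields-27366 --as helper`
(K3⁸; count-neutral).  THEOREMS ONLY (0 `def`).  Over dag-n15-b's pair space and Neumann devices (`bgPair`, `bgPropV_fix`, `isUnit_stepV`, `hasMaj_stepV`, `hasMaj_stack`,
`hasMaj_unstack`, `hasMaj_projO_comp`, `projO_some_bgPair_of_comp`, `exists_const_hasMaj_ofBlocks`), `B9SectDWeightedNeumann.neumann_majorant_wrow`, `wrow_of_exp`, dag-n15-a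
K-A `kingJet_uniform_letters` ∕ `tensorId_kingGOp_comp_symbOp_divAdj`, FILE 70a `srcDiv_uniform_letters` BY NAME; nothing in the tree is modified.

WHY (this seat's ARCHITECTURE NOTE «ENTRY 2 LIVE BY PARTS», pub-ymgap INBOX l.43300).  FILE 70c's device (`idef_neumann_majorant_flat`) needs, on the COARSE run, the plain row
of the dressed third entry `Ȳ` and — for the one letter-mismatch term of the by-parts bookkeeping (FILE 69: `b′ − B′` = average of fine shift commutators, each costing
one COARSE difference quotient of the test function) — the row of `N̄∇̄_μȲ = N̄∇̄_μX̄N̄∇̄*_κ`, whose bare part is FILE 68's logarithmic mixed row.  Both follow from ONE Neumann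
series on the stacked carrier: `X̂̄∘N̄∇̄*_κ = stack(S̄_κ, (N̄∇̄_μS̄_κ)_μ) + (ŜV̂)∘(X̂̄∘N̄∇̄*_κ)`.

WHAT.  `stack_comp`; ★★ `srcDivJet_coarse` — `∃ δ r₀ B > 0` such that for every `K ≥ 1`, `n ≥ 1`, cube `2L^e`, mass `0 < m² ≤ m₀²`, `0 ≤ r ≤ r₀` and coarse letters
`|c|, |a_μ| ≤ r`: (i) `IsUnit (1 − [stack Ḡ (N̄∇̄_μḠ)_μ ∘ unstack c a])`; (ii) `HasMaj (X̄∘N̄∇̄*_κ) (B(K+2)e^{−δd})`; (iii) `HasMaj (N̄∇̄_μ∘X̄∘N̄∇̄*_κ) (B(K+2)e^{−δd})`;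
★ `srcDivJet_fine_isUnit` — the fine twin of (i).

HONEST FRAMING ∕ LIMITS.  King's `A = 0` MODEL + abelianised scalar-multiplier species (template literature [King1986] (2.13)–(2.17) p.653, (4.1)–(4.5) p.670;
[Balaban1985BackgroundPropagators] (3.52) p.400, (3.62)–(3.65) pp.402–403: SHAPES ∕ mechanism) — NOT Bałaban's covariant `G(U)`.  NE2⁺ NOT PRINTED ∕ NOT proved; no statement of
record touched; N15 NOT discharged; K3⁸ OPEN; counts UNMOVED (typed 28∕28 · discharged 5∕27); one finite torus per index — NOT ℝ⁴ ∕ infinite volume ∕ OS ∕ mass gap ∕ Clay.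
-/

noncomputable section

open scoped BigOperators Matrix
open Finset

namespace Summit.QuantumFields.YangMills.BalabanUVNodes.N15.KingModel.SrcDiv

open Literature.MathematicalPhysics.QuantumFieldTheory.Balaban1983to89
open Literature.MathematicalPhysics.QuantumFieldTheory.Balaban1983to89.B11SectG (BlockNorm HasMaj)
open Literature.MathematicalPhysics.QuantumFieldTheory.Balaban1983to89.B6RandomWalk (Triangle254)
open Literature.MathematicalPhysics.QuantumFieldTheory.Balaban1983to89.B9SectDWeightedNeumann (WRow neumann_majorant_wrow wrow_of_exp)
open Literature.MathematicalPhysics.QuantumFieldTheory.Balaban1983to89.T4EtaRateDefect (idef)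
open Literature.MathematicalPhysics.QuantumFieldTheory.Balaban1983to89.T4EtaRateCoeffDefect (pull blockAvg diagK)
open Literature.MathematicalPhysics.QuantumFieldTheory.Balaban1983to89.B6Prop26Gluing (mulOp)
open Literature.MathematicalPhysics.QuantumFieldTheory.Balaban1983to89.B5Prop11Plancherel (Tor fine unitVec)
open Literature.MathematicalPhysics.QuantumFieldTheory.King1986.Torus (blockOf tdistT tdistT_nonneg tdistT_triangle)
open Literature.MathematicalPhysics.QuantumFieldTheory.Balaban1983to89.B6UnitTorusCarrier (unitTorusGeo rowSum_unitTorusGeo unitTorusGeo_dist)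
open Summit.QuantumFields.YangMills.BalabanUVNodes.N15.VectorPiece (kingPrV blkFine tensorId)
open Summit.QuantumFields.YangMills.BalabanUVNodes.N15.TwoGrid (symbOp sD sTinv)
open Summit.QuantumFields.YangMills.BalabanUVNodes.N15.TwoGrid.KingJet (kingJet_uniform_letters tensorId_kingGOp_comp_symbOp_divAdj)
open Summit.QuantumFields.YangMills.BalabanUVNodes.N15.BackgroundLayer (stack unstack projO bgPair bgPropV bgPropV_fix isUnit_stepV hasMaj_stepV hasMaj_stack hasMaj_unstack
  hasMaj_projO_comp projO_some_bgPair_of_comp blkPair)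
open Summit.QuantumFields.YangMills.BalabanUVNodes.N15.BackgroundModel (kappa_ofBlocks)
open Summit.QuantumFields.YangMills.BalabanUVNodes.N15.DerivDefect (exists_const_hasMaj_ofBlocks)
open Summit.QuantumFields.YangMills.BalabanUVNodes.N15KingModelRung.Curved (kingGOp kingSOp)

variable {d : ℕ} (L : ℕ) [NeZero L]

/-- A stacked operator composed on the source side is the stack of the compositions. [folklore] -/
theorem stack_comp {X F F' J : Type} [AddCommGroup F] [Module ℝ F] [AddCommGroup F'] [Module ℝ F'] (G : F →ₗ[ℝ] (X → ℝ)) (D : J → F →ₗ[ℝ] (X → ℝ))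
    (T : F' →ₗ[ℝ] F) :
    stack G D ∘ₗ T = stack (G ∘ₗ T) (fun μ => D μ ∘ₗ T) :=
  LinearMap.ext fun _ => funext fun p => by rcases p with ⟨x, _ | μ⟩ <;> rfl

variable (d)

set_option maxHeartbeats 800000 in
/-- ★★ **THE COARSE DRESSED ROWS.**  For odd `L ≥ 3`, `a > 0`, `m₀² ≥ 0`: `∃ δ r₀ B > 0` such that for every `K ≥ 1`, `n ≥ 1`, cube `M_μ = 2L^e`, mass `0 < m² ≤ m₀²`,
`0 ≤ r ≤ r₀` and coarse letters `|c| ≤ r`, `|a_μ| ≤ r` (on King's coarse 1-form carrier): (i) the (3.65) jet's step `1 − [stack Ḡ (N̄∇̄_μḠ)_μ ∘ unstack c a]` is a unit;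
(ii) the dressed third entry `Ȳ_κ = X̄∘N̄∇̄*_κ` (`X̄ = (bgPair …)_none`) has the block majorant `B(K+2)e^{−δ|y−y′|_T}`; (iii) so does its coarse gradient `N̄∇̄_μȲ_κ` —
the dressed mixed operator; the factor `K + 2` is FILE 68's bare logarithm. [cite: Balaban1985BackgroundPropagators, (3.42) p.397 (third entry), (3.52) p.400, (3.62)–(3.65)
pp.402–403 (mechanism); King1986, (2.13) p.653, (4.1)–(4.5) p.670; Balaban1984PropagatorsII, Lemma 2.1 (2.61) p.234] -/
theorem srcDivJet_coarse (hd : 1 ≤ d) (hLodd : Odd L) (hL : 2 ≤ L) {a : ℝ} (ha : 0 < a) {m0sq : ℝ} (hm0 : 0 ≤ m0sq) :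
    ∃ δ r₀ B : ℝ, 0 < δ ∧ 0 < r₀ ∧ 0 < B ∧ ∀ (K : ℕ), 1 ≤ K → ∀ (n : ℕ), 1 ≤ n → ∀ (e : ℕ) (M : Fin (d + 1) → ℕ) [∀ μ, NeZero (M μ)], (∀ μ, M μ = 2 * L ^ e) →
      ∀ (msq : ℝ), 0 < msq → msq ≤ m0sq → ∀ (r : ℝ), 0 ≤ r → r ≤ r₀ →
      ∀ (c : Tor (fine (L ^ K) M) × Fin (d + 1) → ℝ) (av : Fin (d + 1) → Tor (fine (L ^ K) M) × Fin (d + 1) → ℝ),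
      (∀ z, |c z| ≤ r) → (∀ μ z, |av μ z| ≤ r) →
      IsUnit (1 - LinearMap.toMatrix' (stack (tensorId (Fin (d + 1)) (kingGOp L a msq K (L ^ K) M))
          (fun μ => symbOp M (L ^ K) (sD M (L ^ K) μ ((L ^ K : ℕ) : ℝ)) ∘ₗ tensorId (Fin (d + 1)) (kingGOp L a msq K (L ^ K) M)) ∘ₗ unstack c av)) ∧
      (∀ κ, HasMaj (BlockNorm.ofBlocks (unitTorusGeo L K M) (blkFine L K M)) (BlockNorm.ofBlocks (unitTorusGeo L K M) (blkFine L K M))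
          ((projO none ∘ₗ bgPair (tensorId (Fin (d + 1)) (kingGOp L a msq K (L ^ K) M))
              (fun μ => symbOp M (L ^ K) (sD M (L ^ K) μ ((L ^ K : ℕ) : ℝ)) ∘ₗ tensorId (Fin (d + 1)) (kingGOp L a msq K (L ^ K) M)) c av) ∘ₗ
            symbOp M (L ^ K) (((L ^ K : ℕ) : ℝ) • (sTinv M (L ^ K) κ - 1)))
          (fun y y' => B * (((K : ℕ) : ℝ) + 2) * Real.exp (-(δ * tdistT M y y')))) ∧
      (∀ κ μ, HasMaj (BlockNorm.ofBlocks (unitTorusGeo L K M) (blkFine L K M)) (BlockNorm.ofBlocks (unitTorusGeo L K M) (blkFine L K M))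
          (symbOp M (L ^ K) (sD M (L ^ K) μ ((L ^ K : ℕ) : ℝ)) ∘ₗ
            ((projO none ∘ₗ bgPair (tensorId (Fin (d + 1)) (kingGOp L a msq K (L ^ K) M))
                (fun μ => symbOp M (L ^ K) (sD M (L ^ K) μ ((L ^ K : ℕ) : ℝ)) ∘ₗ tensorId (Fin (d + 1)) (kingGOp L a msq K (L ^ K) M)) c av) ∘ₗ
              symbOp M (L ^ K) (((L ^ K : ℕ) : ℝ) • (sTinv M (L ^ K) κ - 1))))
          (fun y y' => B * (((K : ℕ) : ℝ) + 2) * Real.exp (-(δ * tdistT M y y')))) := by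
  obtain ⟨δ₀, β₀, hδ₀, hβ₀, HA⟩ := kingJet_uniform_letters d L hd hLodd hL ha hm0 (γ := 0) le_rfl zero_lt_one
  obtain ⟨δ₁, β₁, hδ₁, hβ₁, HY⟩ := srcDiv_uniform_letters d L hLodd hL ha hm0 (γ := 0) le_rfl zero_lt_one
  -- one rate and one constant for the bare rows
  obtain ⟨δ, hδ⟩ : ∃ δ : ℝ, δ = min δ₀ δ₁ := ⟨_, rfl⟩
  have hδpos : 0 < δ := by rw [hδ]; exact lt_min hδ₀ hδ₁
  have e₀ : δ ≤ δ₀ := by rw [hδ]; exact min_le_left _ _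
  have e₁ : δ ≤ δ₁ := by rw [hδ]; exact min_le_right _ _
  obtain ⟨β, hβ⟩ : ∃ β : ℝ, β = β₀ + β₁ := ⟨_, rfl⟩
  have hβpos : 0 < β := by rw [hβ]; positivity
  have b₀ : β₀ ≤ β := by rw [hβ]; linarith
  have b₁ : β₁ ≤ β := by rw [hβ]; linarith
  -- the Neumann guard: `q = β·r(1 + (d+1))·c_r ≤ ½` for `r ≤ r₀`
  have hσ : 0 < δ / 2 := by positivity
  obtain ⟨cr, hcr_def⟩ : ∃ cr : ℝ, cr = B4Sect5Proof.latticeConst (d + 1) (δ / 2) := ⟨_, rfl⟩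
  have hcr : 0 ≤ cr := by rw [hcr_def]; exact B4Sect5Proof.latticeConst_nonneg (d + 1) hσ.le
  obtain ⟨W, hW_def⟩ : ∃ W : ℝ, W = β * (1 + ((Fintype.card (Fin (d + 1)) : ℕ) : ℝ)) * cr := ⟨_, rfl⟩
  have hW : 0 ≤ W := by rw [hW_def]; positivity
  obtain ⟨r₀, hr₀_def⟩ : ∃ r₀ : ℝ, r₀ = (2 * W + 1)⁻¹ := ⟨_, rfl⟩
  have hr₀ : 0 < r₀ := by rw [hr₀_def]; positivity
  refine ⟨δ / 2, r₀, 2 * β, hσ, hr₀, by positivity, ?_⟩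
  intro K hK n hn e M _ hM msq hmsq hcap r hr hrr₀ c av hc hav
  obtain ⟨hG, hGD, -, -, -, -, -⟩ := HA K hK n hn e M hM msq hmsq hcap
  obtain ⟨hS, -, -, -, -, -, -, hMix⟩ := HY K hK n hn e M hM msq hmsq hcap
  have hdd : ∀ a b : (unitTorusGeo L K M).Site, 0 ≤ (unitTorusGeo L K M).dist a b := fun a b => tdistT_nonneg M a b
  have htri : Triangle254 (unitTorusGeo L K M) := fun a b c => tdistT_triangle M a b c
  have hrow := rowSum_unitTorusGeo L K M hσ
  rw [← hcr_def] at hrow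
  -- the letters at the common `(δ, β)`
  have hG' : HasMaj (BlockNorm.ofBlocks (unitTorusGeo L K M) (blkFine L K M)) (BlockNorm.ofBlocks (unitTorusGeo L K M) (blkFine L K M))
      (tensorId (Fin (d + 1)) (kingGOp L a msq K (L ^ K) M)) (fun y y' => β * Real.exp (-(δ * tdistT M y y'))) :=
    hG.mono fun y y' => mul_le_mul b₀ (Real.exp_le_exp.mpr (by nlinarith [tdistT_nonneg M y y'])) (Real.exp_nonneg _) hβpos.le
  have hGD' : ∀ μ, HasMaj (BlockNorm.ofBlocks (unitTorusGeo L K M) (blkFine L K M)) (BlockNorm.ofBlocks (unitTorusGeo L K M) (blkFine L K M))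
      (symbOp M (L ^ K) (sD M (L ^ K) μ ((L ^ K : ℕ) : ℝ)) ∘ₗ tensorId (Fin (d + 1)) (kingGOp L a msq K (L ^ K) M)) (fun y y' => β * Real.exp (-(δ * tdistT M y y'))) :=
    fun μ => (hGD μ).mono fun y y' => mul_le_mul b₀ (Real.exp_le_exp.mpr (by nlinarith [tdistT_nonneg M y y'])) (Real.exp_nonneg _) hβpos.le
  have hKc : (0 : ℝ) ≤ ((K : ℕ) : ℝ) := Nat.cast_nonneg K
  have hS' : ∀ κ, HasMaj (BlockNorm.ofBlocks (unitTorusGeo L K M) (blkFine L K M)) (BlockNorm.ofBlocks (unitTorusGeo L K M) (blkFine L K M))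
      (tensorId (Fin (d + 1)) (kingSOp L a msq K (L ^ K) M κ)) (fun y y' => β * (((K : ℕ) : ℝ) + 2) * Real.exp (-(δ * tdistT M y y'))) := fun κ =>
    (hS κ).mono fun y y' => mul_le_mul (by nlinarith) (Real.exp_le_exp.mpr (by nlinarith [tdistT_nonneg M y y'])) (Real.exp_nonneg _) (by positivity)
  have hMix' : ∀ κ μ, HasMaj (BlockNorm.ofBlocks (unitTorusGeo L K M) (blkFine L K M)) (BlockNorm.ofBlocks (unitTorusGeo L K M) (blkFine L K M))
      (symbOp M (L ^ K) (sD M (L ^ K) μ ((L ^ K : ℕ) : ℝ)) ∘ₗ tensorId (Fin (d + 1)) (kingSOp L a msq K (L ^ K) M κ))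
      (fun y y' => β * (((K : ℕ) : ℝ) + 2) * Real.exp (-(δ * tdistT M y y'))) := fun κ μ =>
    (hMix κ μ).mono fun y y' => mul_le_mul (by nlinarith) (Real.exp_le_exp.mpr (by nlinarith [tdistT_nonneg M y y'])) (Real.exp_nonneg _) (by positivity)
  -- the stacked `U ≡ 1` layer and the unstacked letters
  have hRd : (0 : ℝ) ≤ r * (1 + ((Fintype.card (Fin (d + 1)) : ℕ) : ℝ)) := by positivity
  have hβe : ∀ y y' : Tor M, 0 ≤ β * Real.exp (-(δ * tdistT M y y')) := fun _ _ => mul_nonneg hβpos.le (Real.exp_nonneg _)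
  have hSG : HasMaj (BlockNorm.ofBlocks (unitTorusGeo L K M) (blkFine L K M)) (BlockNorm.ofBlocks (unitTorusGeo L K M) (blkPair (J := Fin (d + 1)) (blkFine L K M)))
      (stack (tensorId (Fin (d + 1)) (kingGOp L a msq K (L ^ K) M))
        (fun μ => symbOp M (L ^ K) (sD M (L ^ K) μ ((L ^ K : ℕ) : ℝ)) ∘ₗ tensorId (Fin (d + 1)) (kingGOp L a msq K (L ^ K) M)))
      (fun y y' => β * Real.exp (-(δ * tdistT M y y'))) :=
    hasMaj_stack (g := unitTorusGeo L K M) (blkFine L K M) hβe hG' hGD'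
  have hV := hasMaj_unstack (g := unitTorusGeo L K M) (blkFine L K M) hr hc hav
  -- the guard
  have h1 : r₀ * (2 * W + 1) = 1 := by rw [hr₀_def]; exact inv_mul_cancel₀ (by positivity)
  have hqle : β * (r * (1 + ((Fintype.card (Fin (d + 1)) : ℕ) : ℝ))) * cr ≤ r₀ * W := by
    calc β * (r * (1 + ((Fintype.card (Fin (d + 1)) : ℕ) : ℝ))) * cr = r * (β * (1 + ((Fintype.card (Fin (d + 1)) : ℕ) : ℝ)) * cr) := by ring
      _ ≤ r₀ * (β * (1 + ((Fintype.card (Fin (d + 1)) : ℕ) : ℝ)) * cr) := mul_le_mul_of_nonneg_right hrr₀ (by positivity)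
      _ = r₀ * W := by rw [hW_def]
  have hr₀W : r₀ * W ≤ 1 / 2 := by nlinarith [hr₀.le]
  have hq : β * (r * (1 + ((Fintype.card (Fin (d + 1)) : ℕ) : ℝ))) * cr < 1 := by linarith
  have hunit := isUnit_stepV (blkFine L K M) (blkPair (J := Fin (d + 1)) (blkFine L K M)) hdd hrow (by linarith) hβpos.le hRd hSG hV hq
  refine ⟨hunit, ?_⟩
  -- the stacked third-entry jet `A0 := X̂̄∘N̄∇̄*_κ` and its Neumann series
  have hjet : ∀ κ, HasMaj (BlockNorm.ofBlocks (unitTorusGeo L K M) (blkFine L K M)) (BlockNorm.ofBlocks (unitTorusGeo L K M) (blkPair (J := Fin (d + 1)) (blkFine L K M)))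
      (bgPair (tensorId (Fin (d + 1)) (kingGOp L a msq K (L ^ K) M))
          (fun μ => symbOp M (L ^ K) (sD M (L ^ K) μ ((L ^ K : ℕ) : ℝ)) ∘ₗ tensorId (Fin (d + 1)) (kingGOp L a msq K (L ^ K) M)) c av ∘ₗ
        symbOp M (L ^ K) (((L ^ K : ℕ) : ℝ) • (sTinv M (L ^ K) κ - 1)))
      (fun y y' => 2 * β * (((K : ℕ) : ℝ) + 2) * Real.exp (-(δ / 2 * tdistT M y y'))) := by
    intro κ
    -- source: `Ŝ∘N̄∇̄*_κ = stack(S̄_κ, (N̄∇̄_μ S̄_κ)_μ)`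
    have hsrc : HasMaj (BlockNorm.ofBlocks (unitTorusGeo L K M) (blkFine L K M)) (BlockNorm.ofBlocks (unitTorusGeo L K M) (blkPair (J := Fin (d + 1)) (blkFine L K M)))
        (stack (tensorId (Fin (d + 1)) (kingGOp L a msq K (L ^ K) M))
            (fun μ => symbOp M (L ^ K) (sD M (L ^ K) μ ((L ^ K : ℕ) : ℝ)) ∘ₗ tensorId (Fin (d + 1)) (kingGOp L a msq K (L ^ K) M)) ∘ₗ
          symbOp M (L ^ K) (((L ^ K : ℕ) : ℝ) • (sTinv M (L ^ K) κ - 1)))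
        (fun y y' => β * (((K : ℕ) : ℝ) + 2) * Real.exp (-(δ / 2 * tdistT M y y'))) := by
      rw [stack_comp]
      have e1 : tensorId (Fin (d + 1)) (kingGOp L a msq K (L ^ K) M) ∘ₗ symbOp M (L ^ K) (((L ^ K : ℕ) : ℝ) • (sTinv M (L ^ K) κ - 1))
          = tensorId (Fin (d + 1)) (kingSOp L a msq K (L ^ K) M κ) := tensorId_kingGOp_comp_symbOp_divAdj L M a msq K (L ^ K) κ
      have e2 : ∀ μ, (symbOp M (L ^ K) (sD M (L ^ K) μ ((L ^ K : ℕ) : ℝ)) ∘ₗ tensorId (Fin (d + 1)) (kingGOp L a msq K (L ^ K) M)) ∘ₗ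
            symbOp M (L ^ K) (((L ^ K : ℕ) : ℝ) • (sTinv M (L ^ K) κ - 1))
          = symbOp M (L ^ K) (sD M (L ^ K) μ ((L ^ K : ℕ) : ℝ)) ∘ₗ tensorId (Fin (d + 1)) (kingSOp L a msq K (L ^ K) M κ) := fun μ => by
        rw [LinearMap.comp_assoc, e1]
      rw [e1]
      simp only [e2]
      have hw : ∀ y y' : Tor M, β * (((K : ℕ) : ℝ) + 2) * Real.exp (-(δ * tdistT M y y')) ≤ β * (((K : ℕ) : ℝ) + 2) * Real.exp (-(δ / 2 * tdistT M y y')) :=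
        fun y y' => mul_le_mul_of_nonneg_left (Real.exp_le_exp.mpr (by nlinarith [tdistT_nonneg M y y'])) (by positivity)
      exact hasMaj_stack (g := unitTorusGeo L K M) (blkFine L K M) (G := tensorId (Fin (d + 1)) (kingSOp L a msq K (L ^ K) M κ))
        (D := fun μ => symbOp M (L ^ K) (sD M (L ^ K) μ ((L ^ K : ℕ) : ℝ)) ∘ₗ tensorId (Fin (d + 1)) (kingSOp L a msq K (L ^ K) M κ))
        (K := fun y y' => β * (((K : ℕ) : ℝ) + 2) * Real.exp (-(δ / 2 * tdistT M y y')))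
        (fun y y' => by positivity) ((hS' κ).mono hw) (fun μ => (hMix' κ μ).mono hw)
    have hstep := hasMaj_stepV (g := unitTorusGeo L K M) (blkFine L K M) (blkPair (J := Fin (d + 1)) (blkFine L K M))
      (G := stack (tensorId (Fin (d + 1)) (kingGOp L a msq K (L ^ K) M))
        (fun μ => symbOp M (L ^ K) (sD M (L ^ K) μ ((L ^ K : ℕ) : ℝ)) ∘ₗ tensorId (Fin (d + 1)) (kingGOp L a msq K (L ^ K) M)))
      (V := unstack c av) hβpos.le hSG hV
    have hwrow : WRow (unitTorusGeo L K M) (δ / 2) (fun y y' => β * (r * (1 + ((Fintype.card (Fin (d + 1)) : ℕ) : ℝ))) * Real.exp (-(δ * (unitTorusGeo L K M).dist y y')))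
        (β * (r * (1 + ((Fintype.card (Fin (d + 1)) : ℕ) : ℝ))) * cr) := wrow_of_exp hdd hrow (mul_nonneg hβpos.le hRd) (by linarith)
    have hfix0 := bgPropV_fix hunit
    have hfix : bgPair (tensorId (Fin (d + 1)) (kingGOp L a msq K (L ^ K) M))
          (fun μ => symbOp M (L ^ K) (sD M (L ^ K) μ ((L ^ K : ℕ) : ℝ)) ∘ₗ tensorId (Fin (d + 1)) (kingGOp L a msq K (L ^ K) M)) c av ∘ₗ
          symbOp M (L ^ K) (((L ^ K : ℕ) : ℝ) • (sTinv M (L ^ K) κ - 1))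
        = stack (tensorId (Fin (d + 1)) (kingGOp L a msq K (L ^ K) M))
            (fun μ => symbOp M (L ^ K) (sD M (L ^ K) μ ((L ^ K : ℕ) : ℝ)) ∘ₗ tensorId (Fin (d + 1)) (kingGOp L a msq K (L ^ K) M)) ∘ₗ
            symbOp M (L ^ K) (((L ^ K : ℕ) : ℝ) • (sTinv M (L ^ K) κ - 1))
          + (stack (tensorId (Fin (d + 1)) (kingGOp L a msq K (L ^ K) M))
              (fun μ => symbOp M (L ^ K) (sD M (L ^ K) μ ((L ^ K : ℕ) : ℝ)) ∘ₗ tensorId (Fin (d + 1)) (kingGOp L a msq K (L ^ K) M)) ∘ₗ unstack c av) ∘ₗ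
            (bgPair (tensorId (Fin (d + 1)) (kingGOp L a msq K (L ^ K) M))
                (fun μ => symbOp M (L ^ K) (sD M (L ^ K) μ ((L ^ K : ℕ) : ℝ)) ∘ₗ tensorId (Fin (d + 1)) (kingGOp L a msq K (L ^ K) M)) c av ∘ₗ
              symbOp M (L ^ K) (((L ^ K : ℕ) : ℝ) • (sTinv M (L ^ K) κ - 1))) := by
      unfold bgPair
      conv_lhs => rw [hfix0]
      rw [LinearMap.add_comp, LinearMap.comp_assoc]
    obtain ⟨M₀, hM₀, hap⟩ := exists_const_hasMaj_ofBlocks (g := unitTorusGeo L K M) (blkFine L K M) (blkPair (J := Fin (d + 1)) (blkFine L K M))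
      (bgPair (tensorId (Fin (d + 1)) (kingGOp L a msq K (L ^ K) M))
          (fun μ => symbOp M (L ^ K) (sD M (L ^ K) μ ((L ^ K : ℕ) : ℝ)) ∘ₗ tensorId (Fin (d + 1)) (kingGOp L a msq K (L ^ K) M)) c av ∘ₗ
        symbOp M (L ^ K) (((L ^ K : ℕ) : ℝ) • (sTinv M (L ^ K) κ - 1)))
    have hq1 : (BlockNorm.ofBlocks (unitTorusGeo L K M) (blkPair (J := Fin (d + 1)) (blkFine L K M))).κ * (β * (r * (1 + ((Fintype.card (Fin (d + 1)) : ℕ) : ℝ))) * cr) < 1 := by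
      rw [kappa_ofBlocks, one_mul]; exact hq
    have key := neumann_majorant_wrow htri hdd hσ.le (fun _ _ => mul_nonneg (mul_nonneg hβpos.le hRd) (Real.exp_nonneg _)) hwrow (by positivity) hM₀ hstep hsrc hfix hap hq1
    refine key.mono fun y y' => ?_
    rw [kappa_ofBlocks, one_mul]
    have hq2 : (1 - β * (r * (1 + ((Fintype.card (Fin (d + 1)) : ℕ) : ℝ))) * cr)⁻¹ ≤ 2 := by
      calc (1 - β * (r * (1 + ((Fintype.card (Fin (d + 1)) : ℕ) : ℝ))) * cr)⁻¹ ≤ (1 / 2)⁻¹ := inv_anti₀ (by norm_num) (by linarith)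
        _ = 2 := by norm_num
    have hE := Real.exp_nonneg (-(δ / 2 * (unitTorusGeo L K M).dist y y'))
    have h0 : 0 ≤ β * (((K : ℕ) : ℝ) + 2) := by positivity
    calc β * (((K : ℕ) : ℝ) + 2) * (1 - β * (r * (1 + ((Fintype.card (Fin (d + 1)) : ℕ) : ℝ))) * cr)⁻¹ * Real.exp (-(δ / 2 * (unitTorusGeo L K M).dist y y'))
        ≤ β * (((K : ℕ) : ℝ) + 2) * 2 * Real.exp (-(δ / 2 * (unitTorusGeo L K M).dist y y')) :=
          mul_le_mul_of_nonneg_right (mul_le_mul_of_nonneg_left hq2 h0) hE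
      _ = 2 * β * (((K : ℕ) : ℝ) + 2) * Real.exp (-(δ / 2 * tdistT M y y')) := by rw [unitTorusGeo_dist]; ring
  refine ⟨fun κ => ?_, fun κ μ => ?_⟩
  · have h := hasMaj_projO_comp (g := unitTorusGeo L K M) (J := Fin (d + 1)) (blkFine L K M) (hjet κ) none
    rw [← LinearMap.comp_assoc] at h
    exact h
  · have h := hasMaj_projO_comp (g := unitTorusGeo L K M) (J := Fin (d + 1)) (blkFine L K M) (hjet κ) (some μ)
    rw [← LinearMap.comp_assoc, projO_some_bgPair_of_comp hunit rfl, LinearMap.comp_assoc] at h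
    exact h

/-- ★ **THE FINE JET's STEP IS A UNIT** (the fine twin of (i); the fine by-parts fixed point of FILE 69 is available). [cite: Balaban1985BackgroundPropagators, (3.65) p.403] -/
theorem srcDivJet_fine_isUnit (hd : 1 ≤ d) (hLodd : Odd L) (hL : 2 ≤ L) {a : ℝ} (ha : 0 < a) {m0sq : ℝ} (hm0 : 0 ≤ m0sq) :
    ∃ r₀ : ℝ, 0 < r₀ ∧ ∀ (K : ℕ), 1 ≤ K → ∀ (n : ℕ), 1 ≤ n → ∀ (e : ℕ) (M : Fin (d + 1) → ℕ) [∀ μ, NeZero (M μ)], (∀ μ, M μ = 2 * L ^ e) →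
      ∀ (msq : ℝ), 0 < msq → msq ≤ m0sq → ∀ (r : ℝ), 0 ≤ r → r ≤ r₀ →
      ∀ (c' : Tor (fine (L ^ n * L ^ K) M) × Fin (d + 1) → ℝ) (a' : Fin (d + 1) → Tor (fine (L ^ n * L ^ K) M) × Fin (d + 1) → ℝ),
      (∀ z, |c' z| ≤ r) → (∀ μ z, |a' μ z| ≤ r) →
      IsUnit (1 - LinearMap.toMatrix' (stack (tensorId (Fin (d + 1)) (kingGOp L a msq (K + n) (L ^ n * L ^ K) M))
          (fun μ => symbOp M (L ^ n * L ^ K) (sD M (L ^ n * L ^ K) μ ((L ^ n * L ^ K : ℕ) : ℝ)) ∘ₗ tensorId (Fin (d + 1)) (kingGOp L a msq (K + n) (L ^ n * L ^ K) M)) ∘ₗ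
            unstack c' a')) := by
  obtain ⟨δ₀, β, hδ₀, hβ, HA⟩ := kingJet_uniform_letters d L hd hLodd hL ha hm0 (γ := 0) le_rfl zero_lt_one
  have hσ : 0 < δ₀ / 2 := by positivity
  obtain ⟨cr, hcr_def⟩ : ∃ cr : ℝ, cr = B4Sect5Proof.latticeConst (d + 1) (δ₀ / 2) := ⟨_, rfl⟩
  have hcr : 0 ≤ cr := by rw [hcr_def]; exact B4Sect5Proof.latticeConst_nonneg (d + 1) hσ.le
  obtain ⟨W, hW_def⟩ : ∃ W : ℝ, W = β * (1 + ((Fintype.card (Fin (d + 1)) : ℕ) : ℝ)) * cr := ⟨_, rfl⟩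
  have hW : 0 ≤ W := by rw [hW_def]; positivity
  refine ⟨(2 * W + 1)⁻¹, by positivity, ?_⟩
  intro K hK n hn e M _ hM msq hmsq hcap r hr hrr₀ c' a' hc' ha'
  obtain ⟨-, -, hG', hG'D, -, -, -⟩ := HA K hK n hn e M hM msq hmsq hcap
  have hdd : ∀ a b : (unitTorusGeo L K M).Site, 0 ≤ (unitTorusGeo L K M).dist a b := fun a b => tdistT_nonneg M a b
  have hrow := rowSum_unitTorusGeo L K M hσ
  rw [← hcr_def] at hrow
  have hRd : (0 : ℝ) ≤ r * (1 + ((Fintype.card (Fin (d + 1)) : ℕ) : ℝ)) := by positivity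
  have hβe : ∀ y y' : Tor M, 0 ≤ β * Real.exp (-(δ₀ * tdistT M y y')) := fun _ _ => mul_nonneg hβ.le (Real.exp_nonneg _)
  have hSG : HasMaj (BlockNorm.ofBlocks (unitTorusGeo L K M) (fun i : Tor (fine (L ^ n * L ^ K) M) × Fin (d + 1) => blockOf (L ^ n * L ^ K) M i.1))
      (BlockNorm.ofBlocks (unitTorusGeo L K M) (blkPair (J := Fin (d + 1)) fun i : Tor (fine (L ^ n * L ^ K) M) × Fin (d + 1) => blockOf (L ^ n * L ^ K) M i.1))
      (stack (tensorId (Fin (d + 1)) (kingGOp L a msq (K + n) (L ^ n * L ^ K) M))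
        (fun μ => symbOp M (L ^ n * L ^ K) (sD M (L ^ n * L ^ K) μ ((L ^ n * L ^ K : ℕ) : ℝ)) ∘ₗ tensorId (Fin (d + 1)) (kingGOp L a msq (K + n) (L ^ n * L ^ K) M)))
      (fun y y' => β * Real.exp (-(δ₀ * tdistT M y y'))) :=
    hasMaj_stack (g := unitTorusGeo L K M) _ hβe hG' hG'D
  have hV := hasMaj_unstack (g := unitTorusGeo L K M) (fun i : Tor (fine (L ^ n * L ^ K) M) × Fin (d + 1) => blockOf (L ^ n * L ^ K) M i.1) hr hc' ha'
  have h1 : (2 * W + 1)⁻¹ * (2 * W + 1) = 1 := inv_mul_cancel₀ (by positivity)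
  have hr₀ : (0 : ℝ) < (2 * W + 1)⁻¹ := by positivity
  have hqle : β * (r * (1 + ((Fintype.card (Fin (d + 1)) : ℕ) : ℝ))) * cr ≤ (2 * W + 1)⁻¹ * W := by
    calc β * (r * (1 + ((Fintype.card (Fin (d + 1)) : ℕ) : ℝ))) * cr = r * (β * (1 + ((Fintype.card (Fin (d + 1)) : ℕ) : ℝ)) * cr) := by ring
      _ ≤ (2 * W + 1)⁻¹ * (β * (1 + ((Fintype.card (Fin (d + 1)) : ℕ) : ℝ)) * cr) := mul_le_mul_of_nonneg_right hrr₀ (by positivity)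
      _ = (2 * W + 1)⁻¹ * W := by rw [hW_def]
  have hr₀W : (2 * W + 1)⁻¹ * W ≤ 1 / 2 := by nlinarith [hr₀.le]
  have hq : β * (r * (1 + ((Fintype.card (Fin (d + 1)) : ℕ) : ℝ))) * cr < 1 := by linarith
  exact isUnit_stepV (fun i : Tor (fine (L ^ n * L ^ K) M) × Fin (d + 1) => blockOf (L ^ n * L ^ K) M i.1)
    (blkPair fun i : Tor (fine (L ^ n * L ^ K) M) × Fin (d + 1) => blockOf (L ^ n * L ^ K) M i.1) hdd hrow (by linarith) hβ.le hRd hSG hV hq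

end Summit.QuantumFields.YangMills.BalabanUVNodes.N15.KingModel.SrcDiv
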